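import Summits.Ventures.AbcSig.Rows.Bridge
import Summits.Ventures.AbcSig.Rows.C2aL157A0S
import Summits.Ventures.AbcSig.Rows.C2aL157A0SAB

/-!
# Venture AbcSig — CELL `C2aL157A0S`: the census statement `Rows.C2aCellRed 157 (fun a => a = 0) ∅` from the two row theorems

HONEST FRAMING. COMPUTATION cell `pub-abcsig`; CONDITIONAL theorem; no claim on ABC or any summit. Hypotheses exactly as in
`Rows/C2aL157A0S.lean` and `Rows/C2aL157A0SAB.lean`: `BS04Package` (CITED), `DataComplete` / `RefinesCPSymAll` (COMPUTED, certified level files;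
norm-form certificates), `EisPackage` (CITED) + `Refines` (COMPUTED) for the kernel M6 discharges, and the rows' per-orbit CITED exclusions universally quantified in the exponent
(shared by both distributions (a = 0: the second is the first with x, y swapped)). Conclusion = p1's census predicate (`Rows/Statements.lean`) with the residual of the row of
record `census/rows/C2a/C2a-l157-a0.md` (sha16 `506458a07984df17`): all four coprime distributions `A·B = 2^0·157^m`, reduced exponents.
GENERATED by p-lean g5 `gen5/c2arow4.py` (pattern of `Rows/C2aL277A0XCell.lean`).
-/

namespace Summit.Ventures.AbcSig

/-- Cell `C2aL157A0S`: `Rows.C2aCellRed 157 (fun a => a = 0) ∅` under the rows' hypotheses. -/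
theorem xcell_C2aL157A0S (M : NewformModel) (hP : M.BS04Package)
    (hE : M.EisPackage)
    (hR_orbit_314_3 : M.Refines 314 orbit_314_3 m6X_314_3)
    (hRB_orbit_314_2 : ∀ f : M.Form 314, M.Matches f orbit_314_2 → M.Matches f rb_314_2)
    (hD5024 : M.DataComplete 5024 level5024Orbits)
    (hD314 : M.DataComplete 314 level314Orbits)
    (hX_orbit_5024_4 : ∀ n m : ℕ, n ∈ ([17] : List ℕ) → M.Excludes 5024 orbit_5024_4 (famB (2 ^ 0 * 157 ^ m) n (fun _ _ => True))) :
    Rows.C2aCellRed 157 (fun a => a = 0) ∅ :=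
  C2aCellRed_of_rows 157 (by norm_num) (by norm_num) _ _
    (fun n hn h11 hnℓ _ a m (ha : a = 0) han hm hmn x y z h1 h2 => by
      subst ha
      exact xrow_C2aL157A0S M hP hE hR_orbit_314_3 hRB_orbit_314_2 hD5024 hD314 n hn h11 hnℓ  m hm hmn (hX_orbit_5024_4 n m) x y z h1 h2)
    (fun n hn h11 hnℓ _ a m (ha : a = 0) han hm hmn x y z h1 h2 => by
      subst ha
      exact xrow_C2aL157A0SAB M hP hE hR_orbit_314_3 hRB_orbit_314_2 hD5024 hD314 n hn h11 hnℓ  m hm hmn (hX_orbit_5024_4 n m) x y z h1 h2)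

end Summit.Ventures.AbcSig
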